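import Literature.Analysis.FluidPDE.PassiveVectorTensorTransverseKernel
import Mathlib.Topology.Algebra.Module.FiniteDimension
import Mathlib.LinearAlgebra.Basis.VectorSpace
import Mathlib.Analysis.Normed.Module.FiniteDimension
import HarnessLib

/-!
# Transverse canonicalisation of fourth-order viscosity tensors (tool T♮1 of the `ad-ideate`
# canonicalisation device)

Analysis/FluidPDE proof file (everything proved; no definitions, no named facts, no `sorry`), sequel of
`PassiveVectorTensorTransverseKernel.lean` (T♮0: `Torus.TransverseEq`, `Torus.FullBound`, the probe list and
the classification of transverse-null tensors at `d = 3`).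

* `Torus.abs_bsymb_le_window_add_odd` (any `d`): under the transverse window `NearIso 𝔹 lo hi` (Giaquinta's
  Legendre–Hadamard window, `lo` of EITHER sign) and the odd-part bound `OddSmall 𝔹 β` (`0 ≤ β`), for
  `p, q ⊥ k`: `|β_𝔹(k; p, q)| ≤ (max |lo| |hi| + β)·|k|²(|p|² + |q|²)/2` (symmetric part by POLARISATION
  `2(β(p,q) + β(q,p)) = σ(p+q) − σ(p−q)`, odd part by `OddSmall` and `|p||q| ≤ (|p|²+|q|²)/2`).
* `Torus.transverseCanonical` (`d = 3`) — **T♮1**: there is an absolute `C♮ ≥ 0` such that every `𝔹` with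
  `NearIso 𝔹 lo hi`, `OddSmall 𝔹 β`, `0 ≤ β` is transversely equivalent to a representative `𝔹'` with the same
  window and odd bound and `FullBound 𝔹' (C♮·(max |lo| |hi| + β))` — VERBATIM the body of the `ad-ideate`
  (ℓ3-A) text `TransverseCanonical`.  Proof: the probe map `Φ : Visc4 (Fin 3) →ₗ ℝ³⁷`,
  `𝔸 ↦ (β_𝔸(probe m))_m`, has kernel contained in the transverse-null tensors (T♮0, finite criterion
  `transverseEq_of_probes`); a linear right inverse `g` of `Φ` on its range is bounded (finite dimension,
  `LinearMap.toContinuousLinearMap`), `𝔹' := g(Φ 𝔹)` has `Φ 𝔹' = Φ 𝔹` and entries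
  `≤ ‖g‖·‖Φ 𝔹‖_∞ ≤ ‖g‖·W·(max|lo||hi| + β)` by the polarisation bound on each probe, and the entrywise
  criterion `fullBound_of_entry_le` gives `C♮ = 9‖g‖W`.  No kernel dimension count is used.

References: M. Giaquinta, *Multiple integrals in the calculus of variations and nonlinear elliptic systems*
(1983), Ch. III §2 (2.1)–(2.3) [Giaquinta1983MultipleIntegrals]; J. E. Avron, Odd viscosity (1998), §2
[Avron1998OddViscosity].
-/

noncomputable section

open Finset

namespace Literature.Analysis.FluidPDE.Torus

/-! ## T♮1 — transverse canonicalisation -/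

section Canonical

variable {d : Type*} [Fintype d]

/-- **Transverse bound of the bilinear symbol by the window and the odd part (polarisation).**  Under
`NearIso 𝔹 lo hi` and `OddSmall 𝔹 β` (`0 ≤ β`), for `p, q ⊥ k`:
`|β_𝔹(k; p, q)| ≤ (max |lo| |hi| + β) · |k|² (|p|² + |q|²)/2` — the symmetric part by polarisation
`2(β(p,q)+β(q,p)) = σ(p+q) − σ(p−q)` of the window `|σ_𝔹(k,u)| ≤ max|lo||hi|·|k|²|u|²` (valid for `lo` of
either sign), the odd part by `OddSmall` and `|p||q| ≤ (|p|²+|q|²)/2`.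
[cite: Giaquinta1983MultipleIntegrals, Ch. III §2 eq. (2.1)-(2.3)] [cite: Avron1998OddViscosity, §2 eq. (1)-(2)] -/
theorem abs_bsymb_le_window_add_odd {𝔹 : Visc4 d} {lo hi β : ℝ} (hN : NearIso 𝔹 lo hi) (hO : OddSmall 𝔹 β)
    (hβ : 0 ≤ β) {k p q : d → ℝ} (hp : ∑ l, p l * k l = 0) (hq : ∑ l, q l * k l = 0) :
    |bsymb 𝔹 k p q| ≤
      (max |lo| |hi| + β) * ((∑ a, k a ^ 2) * ((∑ i, p i ^ 2) + ∑ i, q i ^ 2) / 2) := by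
  set K := ∑ a, k a ^ 2 with hK
  set P := ∑ i, p i ^ 2 with hP
  set Q := ∑ i, q i ^ 2 with hQ
  set h := max |lo| |hi| with hh
  have hK0 : 0 ≤ K := by rw [hK]; positivity
  have hP0 : 0 ≤ P := by rw [hP]; positivity
  have hQ0 : 0 ≤ Q := by rw [hQ]; positivity
  have hh0 : 0 ≤ h := (abs_nonneg lo).trans (le_max_left _ _)
  -- the window bound for the quadratic symbol on transverse vectors, `lo` of either sign
  have win : ∀ u : d → ℝ, ∑ l, u l * k l = 0 → |symb 𝔹 k u| ≤ h * (K * ∑ i, u i ^ 2) := by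
    intro u hu
    have hU0 : 0 ≤ K * ∑ i, u i ^ 2 := mul_nonneg hK0 (by positivity)
    obtain ⟨h1, h2⟩ := hN k u hu
    rw [abs_le]
    constructor
    · have : -h ≤ lo := (neg_le_neg (le_max_left _ _)).trans (neg_abs_le lo)
      nlinarith
    · have : hi ≤ h := (le_abs_self hi).trans (le_max_right _ _)
      nlinarith
  have hpq : ∑ l, (p + q) l * k l = 0 := by
    simp only [Pi.add_apply, add_mul, Finset.sum_add_distrib, hp, hq, add_zero]
  have hpq' : ∑ l, (p - q) l * k l = 0 := by
    simp only [Pi.sub_apply, sub_mul, Finset.sum_sub_distrib, hp, hq, sub_zero]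
  -- polarisation
  have pol : symb 𝔹 k (p + q) - symb 𝔹 k (p - q) = 2 * (bsymb 𝔹 k p q + bsymb 𝔹 k q p) := by
    unfold symb bsymb
    simp only [Pi.add_apply, Pi.sub_apply, mul_add, Finset.mul_sum, ← Finset.sum_add_distrib,
      ← Finset.sum_sub_distrib]
    refine Finset.sum_congr rfl fun i _ => Finset.sum_congr rfl fun a _ => Finset.sum_congr rfl fun j _ =>
      Finset.sum_congr rfl fun b _ => ?_
    ring
  have para : (∑ i, (p + q) i ^ 2) + ∑ i, (p - q) i ^ 2 = 2 * (P + Q) := by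
    rw [hP, hQ, mul_add, Finset.mul_sum, Finset.mul_sum, ← Finset.sum_add_distrib, ← Finset.sum_add_distrib]
    refine Finset.sum_congr rfl fun i _ => ?_
    simp only [Pi.add_apply, Pi.sub_apply]; ring
  have hs : |bsymb 𝔹 k p q + bsymb 𝔹 k q p| ≤ h * (K * (P + Q)) := by
    have e1 := win (p + q) hpq
    have e2 := win (p - q) hpq'
    have : |symb 𝔹 k (p + q) - symb 𝔹 k (p - q)| ≤ h * (K * ∑ i, (p + q) i ^ 2) + h * (K * ∑ i, (p - q) i ^ 2) :=
      (abs_sub _ _).trans (add_le_add e1 e2)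
    rw [pol, abs_mul, abs_two] at this
    have e3 : h * (K * ∑ i, (p + q) i ^ 2) + h * (K * ∑ i, (p - q) i ^ 2) = 2 * (h * (K * (P + Q))) := by
      rw [← mul_add, ← mul_add, para]; ring
    linarith
  have ho : |bsymb 𝔹 k p q - bsymb 𝔹 k q p| ≤ β * (K * (P + Q)) / 2 := by
    have e1 := hO k p q hp hq
    refine abs_le_of_sq_le_sq ?_ (by positivity)
    calc (bsymb 𝔹 k p q - bsymb 𝔹 k q p) ^ 2 ≤ β ^ 2 * (K ^ 2 * (P * Q)) := e1
      _ ≤ (β * (K * (P + Q)) / 2) ^ 2 := by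
          rw [show (β * (K * (P + Q)) / 2) ^ 2 = β ^ 2 * (K ^ 2 * ((P + Q) ^ 2 / 4)) by ring]
          gcongr
          nlinarith [sq_nonneg (P - Q)]
  have e : bsymb 𝔹 k p q = ((bsymb 𝔹 k p q + bsymb 𝔹 k q p) + (bsymb 𝔹 k p q - bsymb 𝔹 k q p)) / 2 := by ring
  rw [e, abs_div, abs_two]
  have hKPQ : 0 ≤ K * (P + Q) := mul_nonneg hK0 (add_nonneg hP0 hQ0)
  calc |bsymb 𝔹 k p q + bsymb 𝔹 k q p + (bsymb 𝔹 k p q - bsymb 𝔹 k q p)| / 2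
      ≤ (h * (K * (P + Q)) + β * (K * (P + Q)) / 2) / 2 := by gcongr; exact (abs_add_le _ _).trans (add_le_add hs ho)
    _ ≤ (h + β) * (K * (P + Q) / 2) := by nlinarith

end Canonical

section CanonicalThree

/-- **T♮1 — TRANSVERSE CANONICALISATION (`d = 3`).**  There is an absolute constant `C♮ ≥ 0` such that every
tensor in the transverse window `NearIso 𝔹 lo hi` with odd part `OddSmall 𝔹 β` (`0 ≤ β`) is transversely
equivalent to a representative `𝔹'` with the SAME window and odd bound and with FULL bound
`FullBound 𝔹' (C♮ · (max |lo| |hi| + β))` (the body of the `ad-ideate` text `TransverseCanonical`).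
Proof: the probe map `Φ : Visc4 (Fin 3) → ℝ³⁷` is linear with kernel the transverse-null tensors (T♮0,
finite criterion); a linear right inverse on its range is bounded (finite dimension), and
`|Φ 𝔹|_∞ ≤ (max|lo||hi| + β)·W` by the polarisation bound on each probe.
[cite: Giaquinta1983MultipleIntegrals, Ch. III §2 eq. (2.1)-(2.3)] [cite: Avron1998OddViscosity, §2 eq. (1)-(2)] -/
theorem transverseCanonical :
    ∃ Cn : ℝ, 0 ≤ Cn ∧ ∀ (𝔹 : Visc4 (Fin 3)) (lo hi β : ℝ), 0 ≤ β → NearIso 𝔹 lo hi → OddSmall 𝔹 β →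
      ∃ 𝔹' : Visc4 (Fin 3), TransverseEq 𝔹 𝔹' ∧ NearIso 𝔹' lo hi ∧ OddSmall 𝔹' β ∧
        FullBound 𝔹' (Cn * (max |lo| |hi| + β)) := by
  -- the probe map
  let Φ : Visc4 (Fin 3) →ₗ[ℝ] (Fin 37 → ℝ) :=
    { toFun := fun 𝔸 m => bsymb 𝔸 (probeK m) (probeP m) (probeQ m)
      map_add' := fun 𝔸 𝔹 => funext fun m => bsymb_add _ _ _ _ _
      map_smul' := fun c 𝔸 => funext fun m => by
        simp only [Pi.smul_apply, smul_eq_mul, RingHom.id_apply, bsymb_smul] }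
  have hΦapply : ∀ 𝔸 m, Φ 𝔸 m = bsymb 𝔸 (probeK m) (probeP m) (probeQ m) := fun _ _ => rfl
  -- a linear right inverse of `Φ` on its range; it is bounded (finite dimension)
  obtain ⟨g, hg⟩ := Φ.rangeRestrict.exists_rightInverse_of_surjective (LinearMap.range_rangeRestrict Φ)
  let gC := LinearMap.toContinuousLinearMap g
  -- the probe weights
  let w : Fin 37 → ℝ := fun m =>
    (∑ a, probeK m a ^ 2) * ((∑ i, probeP m i ^ 2) + ∑ i, probeQ m i ^ 2) / 2
  have hw0 : ∀ m, 0 ≤ w m := fun m => by positivity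
  let W : ℝ := ∑ m, w m
  have hW0 : 0 ≤ W := Finset.sum_nonneg fun m _ => hw0 m
  have hwW : ∀ m, w m ≤ W := fun m => Finset.single_le_sum (fun m _ => hw0 m) (Finset.mem_univ m)
  refine ⟨(Fintype.card (Fin 3) : ℝ) ^ 2 * (‖gC‖ * W), by positivity, fun 𝔹 lo hi β hβ hN hO => ?_⟩
  set hmax := max |lo| |hi| with hh
  have hh0 : 0 ≤ hmax := (abs_nonneg lo).trans (le_max_left _ _)
  -- the representative
  let 𝔹' : Visc4 (Fin 3) := (g (Φ.rangeRestrict 𝔹) : Visc4 (Fin 3))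
  have hΦ : Φ 𝔹' = Φ 𝔹 := congrArg Subtype.val (LinearMap.congr_fun hg (Φ.rangeRestrict 𝔹))
  have hT : TransverseEq 𝔹 𝔹' :=
    transverseEq_of_probes fun m => by rw [← hΦapply, ← hΦapply, hΦ]
  refine ⟨𝔹', hT, (hT.nearIso_iff lo hi).1 hN, (hT.oddSmall_iff β).1 hO, ?_⟩
  -- the norm bound of the representative
  have h1 : ‖𝔹'‖ ≤ ‖gC‖ * ‖Φ 𝔹‖ := by
    have e := gC.le_opNorm (Φ.rangeRestrict 𝔹)
    rwa [LinearMap.coe_toContinuousLinearMap', Submodule.coe_norm] at e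
  have h2 : ‖Φ 𝔹‖ ≤ (hmax + β) * W := by
    refine (pi_norm_le_iff_of_nonneg (by positivity)).2 fun m => ?_
    rw [hΦapply, Real.norm_eq_abs]
    calc |bsymb 𝔹 (probeK m) (probeP m) (probeQ m)| ≤ (hmax + β) * w m :=
          abs_bsymb_le_window_add_odd hN hO hβ (probe_transverse m).1 (probe_transverse m).2
      _ ≤ (hmax + β) * W := by gcongr; exact hwW m
  have h3 : ∀ i a j b, |𝔹' i a j b| ≤ ‖gC‖ * W * (hmax + β) := by
    intro i a j b
    calc |𝔹' i a j b| = ‖𝔹' i a j b‖ := (Real.norm_eq_abs _).symm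
      _ ≤ ‖𝔹'‖ := (norm_le_pi_norm _ b).trans ((norm_le_pi_norm _ j).trans
          ((norm_le_pi_norm _ a).trans (norm_le_pi_norm _ i)))
      _ ≤ ‖gC‖ * ((hmax + β) * W) := h1.trans (by gcongr)
      _ = ‖gC‖ * W * (hmax + β) := by ring
  have h4 := fullBound_of_entry_le h3
  refine h4.mono (le_of_eq ?_)
  ring

end CanonicalThree

end Literature.Analysis.FluidPDE.Torus
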